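import Mathlib.Algebra.DirectSum.Module
import Mathlib.RingTheory.MvPolynomial.Homogeneous
import Mathlib.LinearAlgebra.TensorProduct.Tower
import Mathlib.LinearAlgebra.FiniteDimensional.Defs
import Literature.AlgebraicGeometry.Motives.Varieties
import Literature.AlgebraicGeometry.Motives.HodgeStructure
import HarnessLib

/-!
# Saito's graded de Rham complexes `Gr^F_k DR(M)` of a pure Hodge module on `ℙᵐ`: the hypercohomology package

Family `hodge`, layer `Literature/AlgebraicGeometry/HodgeTheory`. Definition request
`SaitoGrFDeRham` of route `HodgeConjecture/CurveNetMordellWeil` (to TYPE the engine behind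
`VerticalSupportMiddle`: "every section of `ℍ⁰(ℙ^{2q-1}, Gr^F_{-q} DR(IC(R¹π_*ℚ)))` is supported on a
hypersurface"). This file is the ABSTRACT layer (any polarizable pure Hodge module on `ℙᵐ`); the
companion `SaitoGrFDeRhamCurveNet` pins the package of `IC(R¹π_*ℚ)` of a curve net to the real
carriers `complexBetti`, `classesSupportedOn`, `IsRationalClass`, `IsInHodgeFiltration` of the total
space and states the existence (construction) fact there.

## The mathematics being shadowed (M. Saito)

Let `M` be a polarizable pure Hodge module of weight `m + w` with strict support `ℙᵐ = ℙᵐ_ℂ`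
(equivalently [Popa2017, §4 Thm. 5 = Saito1990]: the intermediate extension `j_{!*}𝕍` of a
polarizable variation of Hodge structure `𝕍` of weight `w` on a Zariski open `U ⊆ ℙᵐ`; for the route,
`𝕍 = R¹π_*ℚ` of a curve net, `w = 1`), with filtered `𝒟`-module `(ℳ, F_•)`. Its de Rham complex is
filtered and the graded pieces
`K_k := Gr^F_k DR(ℳ) = [Gr^F_k ℳ → Ω¹ ⊗ Gr^F_{k+1} ℳ → ⋯ → Ωᵐ ⊗ Gr^F_{k+m} ℳ][m]`
are bounded complexes of COHERENT `𝒪_{ℙᵐ}`-modules in degrees `-m … 0` [Popa2017, §3; Schnell2016,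
§1.2], acyclic for all but finitely many `k` (`F_•` is bounded below, and `⊕_k K_k` is the Koszul
complex of the coherent graded `Gr^F ℳ` on `T^*ℙᵐ`, whose cohomology is finitely generated and killed
by the fibre coordinates). On `U`, `ℳ|_U = 𝒱 ⊗ ω_U` with `F_p ℳ = F^{-p-m}𝒱 ⊗ ω_U`, so
`K_k|_U` is the complex of Hodge bundles `[Ω_U^{m-p} ⊗ Gr_F^{p-k-m} 𝒱]_{p}` with the
`Gr`-Gauss–Manin (Kodaira–Spencer) differentials [Popa2017, §4 (i)] — the planner's (F3). Three
theorems of Saito are consumed by the route, all at the level of HYPERCOHOMOLOGY: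

* (F1, comparison) `IH^{m+j} := Hʲ(ℙᵐ, M) = ℍʲ(ℙᵐ, DR ℳ)` is a polarizable pure `ℚ`-Hodge structure
  of weight `m + w + j` and `ℍʲ(ℙᵐ, K_k) = Gr_F^{-k} IH^{m+j}_ℂ` (direct image for `ℙᵐ → pt` is
  strict: [SaitoMHP1988, Thm. 5.3.1]; Saito's formula `Rⁱf_* Gr_k^F DR = Gr_k^F DR Hⁱf_+`,
  [Popa2017, §4 after Thm. 6]). Check: `ℳ = ω_X`, `Gr^F_{-k} DR(ω_X) = Ωᵏ_X[m-k]` [Popa2017, §5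
  Ex. 9], so `ℍʲ(K_{-k}) = H^{m+j-k}(Ωᵏ) = Gr_F^k H^{m+j}`.
* (F2, KODAIRA–SAITO VANISHING) for `L` ample, `ℍʲ(ℙᵐ, K_k ⊗ L) = 0` for `j > 0` and
  `ℍʲ(ℙᵐ, K_k ⊗ L⁻¹) = 0` for `j < 0` [Saito1990, §2.g; Popa2017, §8 Thm. 23; Schnell2016, Thm. 1];
  here `L = 𝒪(t)`, `t ≥ 1`.
* (supports) for `T ⊆ ℙᵐ` closed with open complement `j_T`, the classes of `IH^m` supported on `T`,
  `IH^m_T := ker(IH^m(ℙᵐ, M) → IH^m(ℙᵐ ∖ T, M)) = im(ℍ⁰(ℙᵐ, DR(i_*i^!M)) → IH^m)`, form a sub-Hodge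
  structure (kernel of a morphism of mixed Hodge structures [Saito1990, Thm. 0.1 and §4.5]); since
  `Gr^F_k DR(i_*i^!ℳ)` is a complex of coherent sheaves set-theoretically supported on `T`
  [Popa2017, §7 Lemma 16 = Saito1990, Lemma 3.2.6], the `Gr_F^{-k}`-components of classes in `IH^m_T`
  are sections of `ℍ⁰(K_k)` killed by a power of any form `F` vanishing on `T` ("coherently
  supported on `V(F)`": `ℍ⁰(ℙᵐ ∖ V(F), K) = colim_N ℍ⁰(ℙᵐ, K(N deg F))`). THE CONVERSE FAILS in
  general (Hodge ≠ pole-order filtration on localisations [Popa2017, §5 Ex. 11]), so the engine of the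
  route must be stated with `ihSupported` (`IsHodgeSupportedSection`), not with coherent support.

## What is defined

* `SaitoGrFDeRhamData m w` — the HYPOTHESIS STRUCTURE recording, for such an `M`: the graded
  `S = ℂ[x₀,…,xₘ]`-modules `H k j = ⊕_t ℍʲ(ℙᵐ, K_k(t))` ("functorial in twists": multiplication by
  forms of degree `e` maps `ℍʲ(K_k(t)) → ℍʲ(K_k(t+e))`), finite-dimensional pieces, amplitude
  (`-m ≤ j ≤ m`, `kmin ≤ k ≤ kmax`), Saito vanishing (F2), the Hodge structures `IH j = IH^{m+j}`
  with the comparison isomorphisms (F1), and the supported sub-Hodge structures with the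
  Hodge-support ⇒ coherent-support link. As for the tree's `Motives.VHSData`: Mathlib has no
  coherent sheaves on schemes, `𝒟`-modules or perverse sheaves, so the complexes `K_k` themselves are
  NOT carried — only what consumers use. No existence is asserted here (companion file).
* `HodgeStructure.grF H p = F^p / F^{p+1}` (graded piece of a Hodge filtration; absolute-name
  dot-notation extension of `Motives.HodgeStructure`), `projHypersurface m F ⊆ ℙᵐ` (zero set of a
  form), `SaitoGrFDeRhamData.IsCoherentlySupportedOn`, `SaitoGrFDeRhamData.IsHodgeSupportedSection`,
  and the API `isCoherentlySupportedOn_of_isHodgeSupportedSection`, `piece_eq_bot_of_mul_pos`.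

## What is deliberately NOT here

* The complexes / terms of `K_k` as sheaves, (F3) as a typed statement, the planner's (F4) ("terms of
  `K_{-q}` through `π_*ω`, its dual and log/V-filtration data": no carrier; the one precise published
  instance, Saito's theorem on Kollár's conjecture `Rⁱπ_* S(ℳ) = S(ℙᵐ, 𝕍ⁱ)` for the LOWEST graded
  piece [Popa2017, §11 Thm. 39], is documentation only), duality [Popa2017, §6 Lemma 13].
* A parametrisation by `Motives.GeometricVHSData B f n i` (the request's wording): no field could
  mention such a `D` honestly (its local system and fibrewise Hodge structures are posited relative to
  a hypothesis structure `B`), so `D` would be a phantom parameter and an existence fact over all `D`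
  vacuous or false for exotic `B`; the honest anchor is the curve net itself (companion file).

## References (statement numbers of [Popa2017] are those of arXiv:1407.3294, held)

* [Saito1990] M. Saito, Mixed Hodge modules, Publ. RIMS 26 (1990): §2.g, Thm. 0.1–0.2, Lemma 3.2.6,
  §4.5. [SaitoMHP1988] M. Saito, Modules de Hodge polarisables, Publ. RIMS 24 (1988): Thm. 5.3.1.
* [Popa2017] M. Popa, Kodaira–Saito vanishing and applications, Enseign. Math. 62: §3, §4 Thm. 5–7,
  §5 Ex. 9–11, §6 Lemma 13, §7 Lemma 16, §8 Thm. 23, §11 Thm. 39. [Schnell2016] §1.2 Thm. 1.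
  [BBD1982] §1.4, §2.1 (intermediate extension).
-/

noncomputable section

open scoped TensorProduct
open CategoryTheory AlgebraicGeometry

universe u

namespace Literature.AlgebraicGeometry.HodgeTheory

section HodgeTheory

/-! ### Graded pieces of a Hodge filtration (dot-notation extensions of `Motives.HodgeStructure`) -/

section GrF

variable {V : Type u} [AddCommGroup V] [Module ℚ V] {n : ℤ}

/-- The graded piece `Gr_F^p V_ℂ = F^p / F^{p+1}` of the Hodge filtration of a Hodge structure
(Deligne, Hodge II, 1.2; for a pure Hodge structure `Gr_F^p ≅ V^{p,n-p}`). Declared by absolute name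
as a dot-notation extension of `Motives.HodgeStructure` (which lives in `Motives/HodgeStructure`).
[cite: DeligneHodgeII1971, 1.2.4–1.2.5] -/
abbrev _root_.Literature.AlgebraicGeometry.Motives.HodgeStructure.grF
    (H : Motives.HodgeStructure V n) (p : ℤ) : Type u :=
  ↥(H.F p) ⧸ Submodule.comap (H.F p).subtype (H.F (p + 1))

/-- The projection `F^p ↠ Gr_F^p`. [cite: DeligneHodgeII1971, 1.2.4–1.2.5] -/
abbrev _root_.Literature.AlgebraicGeometry.Motives.HodgeStructure.grFMk
    (H : Motives.HodgeStructure V n) (p : ℤ) : ↥(H.F p) →ₗ[ℂ] H.grF p :=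
  Submodule.mkQ _

/-- An element of `F^p` has zero class in `Gr_F^p` iff it lies in `F^{p+1}`.
[cite: DeligneHodgeII1971, 1.2.4–1.2.5] -/
theorem _root_.Literature.AlgebraicGeometry.Motives.HodgeStructure.grFMk_eq_zero_iff
    (H : Motives.HodgeStructure V n) (p : ℤ) (x : ↥(H.F p)) :
    H.grFMk p x = 0 ↔ (x : ℂ ⊗[ℚ] V) ∈ H.F (p + 1) := by
  rw [Motives.HodgeStructure.grFMk, Submodule.mkQ_apply, Submodule.Quotient.mk_eq_zero,
    Submodule.mem_comap]
  rfl

end GrF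

/-! ### Hypersurfaces of `ℙᵐ_ℂ` -/

/-- The **hypersurface `V(F) ⊆ ℙᵐ_ℂ`** cut out by a polynomial `F ∈ ℂ[x₀, …, xₘ]` (intended: a
nonzero form of degree `e ≥ 1`): the set of points of `ℙᵐ = Proj ℂ[x₀, …, xₘ]`
(`Motives.projectiveSpace`) whose homogeneous prime contains `F` (Mathlib
`ProjectiveSpectrum.zeroLocus`; Hartshorne II.2 / II.5). For `F = 0` it is everything, for a nonzero
constant it is empty. [folklore] -/
def projHypersurface (m : ℕ) (F : MvPolynomial (Fin (m + 1)) ℂ) :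
    Set (Motives.projectiveSpace m ℂ).left :=
  letI := MvPolynomial.gradedAlgebra (σ := Fin (m + 1)) (R := ℂ)
  ProjectiveSpectrum.zeroLocus (MvPolynomial.homogeneousSubmodule (Fin (m + 1)) ℂ)
    ({F} : Set (MvPolynomial (Fin (m + 1)) ℂ))

/-- `V(0) = ℙᵐ`. [folklore] -/
@[simp]
theorem projHypersurface_zero (m : ℕ) : projHypersurface m 0 = Set.univ := by
  letI := MvPolynomial.gradedAlgebra (σ := Fin (m + 1)) (R := ℂ)
  rw [projHypersurface, ProjectiveSpectrum.zeroLocus_singleton_zero]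
  rfl

/-- `V(F) ⊆ V(F · G)`: a hypersurface lies in every hypersurface it divides. [folklore] -/
theorem projHypersurface_subset_mul (m : ℕ) (F G : MvPolynomial (Fin (m + 1)) ℂ) :
    projHypersurface m F ⊆ projHypersurface m (F * G) := by
  letI := MvPolynomial.gradedAlgebra (σ := Fin (m + 1)) (R := ℂ)
  intro x hx
  have hx' : ({F} : Set (MvPolynomial (Fin (m + 1)) ℂ)) ⊆
      (x : ProjectiveSpectrum (MvPolynomial.homogeneousSubmodule (Fin (m + 1)) ℂ)).asHomogeneousIdeal :=
    hx
  change ({F * G} : Set (MvPolynomial (Fin (m + 1)) ℂ)) ⊆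
      (x : ProjectiveSpectrum (MvPolynomial.homogeneousSubmodule (Fin (m + 1)) ℂ)).asHomogeneousIdeal
  rw [Set.singleton_subset_iff, SetLike.mem_coe, ← HomogeneousIdeal.mem_iff] at hx' ⊢
  exact Ideal.mul_mem_right G _ hx'

/-! ### The hypercohomology package of a pure Hodge module on `ℙᵐ` -/

/-- **Saito's `Gr^F` de Rham package of a polarizable pure Hodge module `M` of weight `m + w` with
strict support `ℙᵐ_ℂ`** (e.g. `M = j_{!*}𝕍` for a polarizable VHS `𝕍` of weight `w` on a Zariski
open `U ⊆ ℙᵐ`), recorded at the level of hypercohomology (module docstring):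

* `H k j`, a graded module over `S = ℂ[x₀,…,xₘ]` whose degree-`t` piece `piece k j t` is
  `ℍʲ(ℙᵐ, K_k(t))`, `K_k = Gr^F_k DR(ℳ)` the `k`-th graded de Rham complex (coherent, degrees
  `-m…0`) twisted by `𝒪(t)`; forms of degree `e` act `ℍʲ(K_k(t)) → ℍʲ(K_k(t+e))`; pieces are
  finite-dimensional and vanish for `j ∉ [-m, m]` and for `k ∉ [kmin, kmax]` (there `K_k` is
  acyclic) [Popa2017, §3; Schnell2016, §1.2];
* KODAIRA–SAITO VANISHING `ℍʲ(K_k(t)) = 0` for `j > 0 < t` and for `j < 0 > t`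
  [Saito1990, §2.g; Popa2017, §8 Thm. 23; Schnell2016, Thm. 1];
* `IH j`, the polarizable pure `ℚ`-Hodge structure `IH^{m+j} = Hʲ(ℙᵐ, M)` of weight `m + w + j`
  (zero for `j ∉ [-m, m]`) with the COMPARISON `ℍʲ(ℙᵐ, K_k) ≅ Gr_F^{-k} IH^{m+j}_ℂ`
  [SaitoMHP1988, Thm. 5.3.1; Popa2017, §4 Thm. 6–7 and Saito's formula];
* `ihSupported T ⊆ IH 0 = IH^m`, the sub-Hodge structure of classes supported on `T ⊆ ℙᵐ`
  (dying on `ℙᵐ ∖ T`), monotone in `T`, everything for `T = ℙᵐ`, and the link "Hodge-supported on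
  `T ⊆ V(F)` ⇒ the `Gr_F^{-k}`-component is killed by a power of `F`" [Saito1990, Lemma 3.2.6;
  Popa2017, §7 Lemma 16].

A hypothesis structure (no sheaves, `𝒟`-modules or perverse sheaves in Mathlib); which `M` is meant
is fixed by the consumer's anchor (see `SaitoGrFDeRhamCurveNet`), and only the twist-`0` data are
pinned by such anchors: the pieces with `t ≠ 0` and the `S`-action have no carrier in the tree, so
(F2) constrains the intended instance only (companion file, "Faithfulness"). [cite: Saito1990, §2.g]
[cite: Popa2017, §3, §4 Thm. 5–7, §8 Thm. 23] [cite: SaitoMHP1988, Thm. 5.3.1] -/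
structure SaitoGrFDeRhamData (m : ℕ) (w : ℤ) : Type 1 where
  /-- Lower end of the `F`-amplitude: `K_k = 0` for `k < kmin`. -/
  kmin : ℤ
  /-- Upper end of the `F`-amplitude: `K_k = 0` for `kmax < k`. -/
  kmax : ℤ
  /-- The graded hypercohomology module `⊕_t ℍʲ(ℙᵐ, K_k(t))`, indexed by `k` and `j`. -/
  H : ℤ → ℤ → Type
  /-- … an abelian group … [cite: Popa2017, §3] -/
  [addCommGroup : ∀ k j, AddCommGroup (H k j)]
  /-- … a `ℂ`-vector space … [cite: Popa2017, §3] -/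
  [module : ∀ k j, Module ℂ (H k j)]
  /-- … a module over the homogeneous coordinate ring `S = ℂ[x₀, …, xₘ]` (cup product with
  `H⁰(ℙᵐ, 𝒪(e)) = S_e`) … [cite: Popa2017, §3] -/
  [moduleS : ∀ k j, Module (MvPolynomial (Fin (m + 1)) ℂ) (H k j)]
  /-- … compatibly with the `ℂ`-structure. [cite: Popa2017, §3] -/
  [isScalarTower : ∀ k j, IsScalarTower ℂ (MvPolynomial (Fin (m + 1)) ℂ) (H k j)]
  /-- The twist grading: `piece k j t = ℍʲ(ℙᵐ, K_k(t)) ⊆ H k j`. -/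
  piece : ∀ k j, ℤ → Submodule ℂ (H k j)
  /-- `H k j = ⊕_t ℍʲ(K_k(t))`. -/
  isInternal_piece : ∀ k j, DirectSum.IsInternal (piece k j)
  /-- Forms of degree `e` map `ℍʲ(K_k(t))` to `ℍʲ(K_k(t + e))` ("functorial in twists"). -/
  smul_mem_piece : ∀ k j (e : ℕ) (t : ℤ) {F : MvPolynomial (Fin (m + 1)) ℂ},
    F ∈ MvPolynomial.homogeneousSubmodule (Fin (m + 1)) ℂ e →
      ∀ {x : H k j}, x ∈ piece k j t → F • x ∈ piece k j (t + e)
  /-- Each `ℍʲ(ℙᵐ, K_k(t))` is finite-dimensional (coherent cohomology on a projective scheme). -/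
  finiteDimensional_piece : ∀ k j t, FiniteDimensional ℂ ↥(piece k j t)
  /-- `K_k = 0` for `k < kmin` (`F_•` is bounded below). -/
  piece_eq_bot_of_lt_kmin : ∀ k j t, k < kmin → piece k j t = ⊥
  /-- `K_k` is acyclic for `kmax < k` (graded Koszul cohomology of `Gr^F ℳ` is bounded). -/
  piece_eq_bot_of_kmax_lt : ∀ k j t, kmax < k → piece k j t = ⊥
  /-- `ℍʲ = 0` for `j < -m` (the complex starts in degree `-m`). -/
  piece_eq_bot_of_lt_neg : ∀ k j t, j < -(m : ℤ) → piece k j t = ⊥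
  /-- `ℍʲ = 0` for `m < j` (coherent cohomological dimension of `ℙᵐ`). -/
  piece_eq_bot_of_lt : ∀ k j t, (m : ℤ) < j → piece k j t = ⊥
  /-- **Kodaira–Saito vanishing**, ample twist: `ℍʲ(ℙᵐ, K_k(t)) = 0` for `j > 0`, `t > 0`.
  [cite: Saito1990, §2.g] [cite: Popa2017, §8 Thm. 23] [cite: Schnell2016, Thm. 1] -/
  piece_eq_bot_of_pos : ∀ k j t, 0 < j → 0 < t → piece k j t = ⊥
  /-- **Kodaira–Saito vanishing**, anti-ample twist: `ℍʲ(ℙᵐ, K_k(t)) = 0` for `j < 0`, `t < 0`.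
  [cite: Saito1990, §2.g] [cite: Popa2017, §8 Thm. 23] [cite: Schnell2016, Thm. 1] -/
  piece_eq_bot_of_neg : ∀ k j t, j < 0 → t < 0 → piece k j t = ⊥
  /-- The rational vector space underlying `IH^{m+j} = Hʲ(ℙᵐ, M)`. -/
  IH : ℤ → Type
  /-- … an abelian group … [cite: SaitoMHP1988, Thm. 5.3.1] -/
  [addCommGroupIH : ∀ j, AddCommGroup (IH j)]
  /-- … a `ℚ`-vector space … [cite: SaitoMHP1988, Thm. 5.3.1] -/
  [moduleIH : ∀ j, Module ℚ (IH j)]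
  /-- … of finite dimension. [cite: SaitoMHP1988, Thm. 5.3.1] -/
  finiteDimensional_IH : ∀ j, FiniteDimensional ℚ (IH j)
  /-- `IH^{m+j} = 0` unless `-m ≤ j ≤ m` (perverse amplitude on `ℙᵐ`). -/
  subsingleton_IH : ∀ j, j < -(m : ℤ) ∨ (m : ℤ) < j → Subsingleton (IH j)
  /-- The pure Hodge structure of weight `m + w + j` on `IH^{m+j} = Hʲ(ℙᵐ, M)` (direct image of the
  weight-`(m + w)` Hodge module `M` to a point). [cite: SaitoMHP1988, Thm. 5.3.1] -/
  hodgeIH : ∀ j, Motives.HodgeStructure (IH j) ((m : ℤ) + w + j)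
  /-- `IH^{m+j}` is polarizable. [cite: SaitoMHP1988, Thm. 5.3.1] -/
  isPolarizable_hodgeIH : ∀ j, (hodgeIH j).IsPolarizable
  /-- **Comparison (F1)**: `ℍʲ(ℙᵐ, Gr^F_k DR ℳ) ≅ Gr_F^{-k} IH^{m+j}_ℂ` (strictness of the direct
  image to a point and Saito's formula). [cite: SaitoMHP1988, Thm. 5.3.1] [cite: Popa2017, §4 Thm. 6] -/
  comparison : ∀ k j, ↥(piece k j 0) ≃ₗ[ℂ] (hodgeIH j).grF (-k)
  /-- The classes of `IH^m = IH 0` supported on a subset `T ⊆ ℙᵐ`: the kernel of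
  `IH^m(ℙᵐ, M) → IH^m(ℙᵐ ∖ T̄, M)`, `T̄` the Zariski closure (intended: `T` a hypersurface), a
  sub-Hodge structure. [cite: Saito1990, Thm. 0.1 and §4.5] -/
  ihSupported : Set (Motives.projectiveSpace m ℂ).left → (hodgeIH 0).SubHodgeStructure
  /-- Supports are monotone: `T ⊆ T' ⇒ IH^m_T ⊆ IH^m_{T'}`. [cite: Saito1990, §4.5] -/
  ihSupported_mono : ∀ {T T' : Set (Motives.projectiveSpace m ℂ).left}, T ⊆ T' →
    (ihSupported T).toSubmodule ≤ (ihSupported T').toSubmodule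
  /-- Everything is supported on `T = ℙᵐ`. [cite: Saito1990, §4.5] -/
  ihSupported_univ : (ihSupported Set.univ).toSubmodule = ⊤
  /-- Only `0` is supported on `T = ∅` (`IH^m(ℙᵐ) → IH^m(ℙᵐ ∖ ∅)` is the identity). [cite: Saito1990, §4.5] -/
  ihSupported_empty : (ihSupported ∅).toSubmodule = ⊥
  /-- **Hodge support ⇒ coherent support**: if `x ∈ F^{-k} IH^m_ℂ` lies in the complexification of
  `IH^m_T` and the polynomial `F` vanishes on `T`, then the section of `ℍ⁰(ℙᵐ, K_k)` corresponding
  to the class of `x` in `Gr_F^{-k}` is killed by a power of `F` in the graded module `⊕_t ℍ⁰(K_k(t))`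
  (`Gr^F_k DR(i_*i^!ℳ)` is a coherent complex annihilated by the local equations of `T`).
  [cite: Saito1990, Lemma 3.2.6] [cite: Popa2017, §7 Lemma 16] -/
  exists_pow_smul_eq_zero : ∀ (T : Set (Motives.projectiveSpace m ℂ).left)
    (F : MvPolynomial (Fin (m + 1)) ℂ), T ⊆ projHypersurface m F →
      ∀ (k : ℤ) (x : ↥((hodgeIH 0).F (-k))),
        (x : ℂ ⊗[ℚ] IH 0) ∈ ((ihSupported T).toSubmodule).baseChange ℂ →
          ∃ N : ℕ, F ^ N • (((comparison k 0).symm ((hodgeIH 0).grFMk (-k) x) : ↥(piece k 0 0)) :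
            H k 0) = 0

namespace SaitoGrFDeRhamData

attribute [instance] addCommGroup module moduleS isScalarTower addCommGroupIH moduleIH

variable {m : ℕ} {w : ℤ} (K : SaitoGrFDeRhamData m w)

/-- The pieces `ℍʲ(ℙᵐ, K_k(t))` are finite-dimensional (instance form of the field). [cite: Popa2017, §3] -/
instance instFiniteDimensionalPiece (k j t : ℤ) : FiniteDimensional ℂ ↥(K.piece k j t) :=
  K.finiteDimensional_piece k j t

/-- The Hodge structures `IH^{m+j}` are finite-dimensional (instance form of the field).
[cite: SaitoMHP1988, Thm. 5.3.1] -/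
instance instFiniteDimensionalIH (j : ℤ) : FiniteDimensional ℚ (K.IH j) :=
  K.finiteDimensional_IH j

/-- **Kodaira–Saito vanishing, combined form**: off degree `0`, `ℍʲ(ℙᵐ, K_k(t)) = 0` as soon as the
twist `t` is nonzero with the sign of `j`. [cite: Saito1990, §2.g] [cite: Popa2017, §8 Thm. 23] -/
theorem piece_eq_bot_of_mul_pos {k j t : ℤ} (h : 0 < j * t) : K.piece k j t = ⊥ := by
  rcases lt_trichotomy 0 j with hj | rfl | hj
  · exact K.piece_eq_bot_of_pos k j t hj (pos_of_mul_pos_right h hj.le)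
  · simp at h
  · exact K.piece_eq_bot_of_neg k j t hj (by nlinarith)

/-- Multiplication by a product of forms raises the twist by the sum of the degrees. [cite: Popa2017, §3] -/
theorem pow_smul_mem_piece {k j : ℤ} {e : ℕ} {t : ℤ} {F : MvPolynomial (Fin (m + 1)) ℂ}
    (hF : F ∈ MvPolynomial.homogeneousSubmodule (Fin (m + 1)) ℂ e) {x : K.H k j}
    (hx : x ∈ K.piece k j t) (N : ℕ) : F ^ N • x ∈ K.piece k j (t + N * e) := by
  induction N with
  | zero => simpa using hx
  | succ N ih =>
    have hmem := K.smul_mem_piece k j e (t + N * e) hF ih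
    rw [← mul_smul, ← pow_succ'] at hmem
    convert hmem using 2
    push_cast
    ring

/-! ### Coherent and Hodge-theoretic support of sections -/

/-- A section `s ∈ ⊕_t ℍʲ(ℙᵐ, K_k(t))` is **coherently supported on the hypersurface `V(F)`** if a
power of `F` kills it; for `s ∈ ℍʲ(K_k(t))` this says `s ↦ 0` in
`ℍʲ(ℙᵐ ∖ V(F), K_k(t)) = colim_N ℍʲ(ℙᵐ, K_k(t + N deg F))` (cohomology and localisation on the
noetherian `ℙᵐ`; Hartshorne III Prop. 2.9 and II Prop. 5.14-type argument). [folklore] -/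
def IsCoherentlySupportedOn {k j : ℤ} (s : K.H k j) (F : MvPolynomial (Fin (m + 1)) ℂ) : Prop :=
  ∃ N : ℕ, F ^ N • s = 0

/-- `0` is coherently supported on every hypersurface. [folklore] -/
theorem IsCoherentlySupportedOn.zero {k j : ℤ} (F : MvPolynomial (Fin (m + 1)) ℂ) :
    K.IsCoherentlySupportedOn (0 : K.H k j) F :=
  ⟨0, smul_zero _⟩

/-- Coherent support on `V(F)` implies coherent support on the larger `V(F · G)`. [folklore] -/
theorem IsCoherentlySupportedOn.mul_right {k j : ℤ} {s : K.H k j} {F : MvPolynomial (Fin (m + 1)) ℂ}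
    (h : K.IsCoherentlySupportedOn s F) (G : MvPolynomial (Fin (m + 1)) ℂ) :
    K.IsCoherentlySupportedOn s (F * G) := by
  obtain ⟨N, hN⟩ := h
  refine ⟨N, ?_⟩
  rw [mul_pow, mul_comm, mul_smul, hN, smul_zero]

/-- Coherently supported sections are closed under addition. [folklore] -/
theorem IsCoherentlySupportedOn.add {k j : ℤ} {s s' : K.H k j} {F : MvPolynomial (Fin (m + 1)) ℂ}
    (h : K.IsCoherentlySupportedOn s F) (h' : K.IsCoherentlySupportedOn s' F) :
    K.IsCoherentlySupportedOn (s + s') F := by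
  obtain ⟨N, hN⟩ := h
  obtain ⟨N', hN'⟩ := h'
  refine ⟨N + N', ?_⟩
  rw [smul_add, pow_add, mul_comm, mul_smul, hN, smul_zero, zero_add, mul_comm, mul_smul, hN',
    smul_zero]

/-- A section `s ∈ ℍ⁰(ℙᵐ, K_k)` is **Hodge-supported on `T`**: under the comparison
`ℍ⁰(K_k) ≅ Gr_F^{-k} IH^m_ℂ` it is the class of an element of `F^{-k} ∩ (IH^m_T)_ℂ`, i.e. it is the
`Gr_F^{-k}`-component of a class of `IH^m` supported on `T` in the sense of mixed Hodge modules. This —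
not coherent support — is the predicate with which the engine of route `CurveNetMordellWeil` has to be
stated (module docstring, "supports"). [cite: Saito1990, Thm. 0.1 and §4.5] -/
def IsHodgeSupportedSection {k : ℤ} (s : ↥(K.piece k 0 0))
    (T : Set (Motives.projectiveSpace m ℂ).left) : Prop :=
  ∃ x : ↥((K.hodgeIH 0).F (-k)), (x : ℂ ⊗[ℚ] K.IH 0) ∈ ((K.ihSupported T).toSubmodule).baseChange ℂ ∧
    (K.comparison k 0).symm ((K.hodgeIH 0).grFMk (-k) x) = s

/-- `0` is Hodge-supported on every `T`. [cite: Saito1990, §4.5] -/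
theorem IsHodgeSupportedSection.zero {k : ℤ} (T : Set (Motives.projectiveSpace m ℂ).left) :
    K.IsHodgeSupportedSection (0 : ↥(K.piece k 0 0)) T :=
  ⟨0, Submodule.zero_mem _, by simp⟩

/-- Hodge support is monotone in `T`. [cite: Saito1990, §4.5] -/
theorem IsHodgeSupportedSection.mono {k : ℤ} {s : ↥(K.piece k 0 0)}
    {T T' : Set (Motives.projectiveSpace m ℂ).left} (h : K.IsHodgeSupportedSection s T)
    (hT : T ⊆ T') : K.IsHodgeSupportedSection s T' := by
  obtain ⟨x, hx, hs⟩ := h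
  exact ⟨x, Submodule.baseChange_mono ℂ (K.ihSupported_mono hT) hx, hs⟩

/-- Only the zero section is Hodge-supported on `∅`. [cite: Saito1990, §4.5] -/
theorem IsHodgeSupportedSection.eq_zero_of_empty {k : ℤ} {s : ↥(K.piece k 0 0)}
    (h : K.IsHodgeSupportedSection s ∅) : s = 0 := by
  obtain ⟨x, hx, rfl⟩ := h
  rw [K.ihSupported_empty, Submodule.baseChange_bot, Submodule.mem_bot] at hx
  have hx0 : x = 0 := Subtype.ext hx
  rw [hx0, map_zero, map_zero]

/-- Every section of `ℍ⁰(ℙᵐ, K_k)` is Hodge-supported on `T = ℙᵐ` (`IH^m_{ℙᵐ} = IH^m` and the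
comparison is onto `Gr_F^{-k}`). [cite: Saito1990, §4.5] -/
theorem isHodgeSupportedSection_univ {k : ℤ} (s : ↥(K.piece k 0 0)) :
    K.IsHodgeSupportedSection s Set.univ := by
  obtain ⟨x, hx⟩ := Submodule.mkQ_surjective _ (K.comparison k 0 s)
  refine ⟨x, ?_, ?_⟩
  · rw [K.ihSupported_univ, Submodule.baseChange_top]
    exact Submodule.mem_top
  · rw [Motives.HodgeStructure.grFMk, hx, LinearEquiv.symm_apply_apply]

/-- **Hodge support implies coherent support**: a section of `ℍ⁰(ℙᵐ, K_k)` Hodge-supported on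
`T ⊆ V(F)` is killed by a power of `F`. (The converse fails in general.)
[cite: Saito1990, Lemma 3.2.6] [cite: Popa2017, §7 Lemma 16] -/
theorem isCoherentlySupportedOn_of_isHodgeSupportedSection {k : ℤ} {s : ↥(K.piece k 0 0)}
    {T : Set (Motives.projectiveSpace m ℂ).left} (h : K.IsHodgeSupportedSection s T)
    {F : MvPolynomial (Fin (m + 1)) ℂ} (hF : T ⊆ projHypersurface m F) :
    K.IsCoherentlySupportedOn (s : K.H k 0) F := by
  obtain ⟨x, hx, rfl⟩ := h
  exact K.exists_pow_smul_eq_zero T F hF k x hx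

end SaitoGrFDeRhamData

end HodgeTheory

end Literature.AlgebraicGeometry.HodgeTheory

end
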